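import Literature.AlgebraicGeometry.Motives.AbelianVarietyLatticeTensor
import Literature.AlgebraicGeometry.Motives.AbelianVarietyEquivariantHomCharacterBound
import HarnessLib

/-!
# Equivariant homomorphisms between lattice tensors: the two-sided character `tr(f ↦ A f B | Hom(Y ⊗ ℤ^ι, Y' ⊗ ℤ^κ))
# = tr(a) tr(b) · tr(h ↦ φ h ψ | Hom(Y, Y'))`, the integral multiplicity formula `|G| · rk V^G = Σ_g tr τ(g)`, and
# `|G| · rk_ℤ Hom_G(Y ⊗ M, Y' ⊗ N) = (Σ_g tr m(g⁻¹) tr n(g)) · rk_ℤ Hom(Y, Y')` (Mazur–Rubin–Silverberg Prop. 1.6 (ii), counted)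

Sequel of `Motives/AbelianVarietyLatticeTensor`.  For two lattice tensors `X = Y ⊗_ℤ M` (bicone `b` over `ι`, matrix representation
`m`, twist `β`, action `ρ` with `ι_j ≫ ρ(g) ≫ π_i = m(g)_{ij} • β(g)`) and `X' = Y' ⊗_ℤ N` (bicone `c` over `κ`, `n`, `β'`, `ρ'`),
Mazur–Rubin–Silverberg Prop. 1.6 gives `Hom(X, X') ≅ Hom_ℤ(M, N) ⊗ Hom(Y, Y')` — a map is its matrix of blocks `ι_j ≫ f ≫ π_k ∈ Hom(Y, Y')`
— `G`-equivariantly, so that (ii) `Hom_{ℤ[G]}(M, N) ⊗ Hom(Y, Y') ↪ Hom_G(X, X')`.  This file COUNTS the equivariant homomorphisms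
`Hom_G(X, X') = {f | ρ(g) ≫ f = f ≫ ρ'(g)}` (the `⨅_g eqLocus` submodule of `Motives/AbelianVarietyEquivariantHomCharacterBound`) exactly:

* §1 **THE INTEGRAL MULTIPLICITY FORMULA `|G| · rk_R V^G = Σ_{g ∈ G} tr τ(g)`** for a representation `τ` of a finite group on a free
  module `V` of finite rank over a principal ideal domain `R` of characteristic `0` (`card_mul_finrank_invariants_eq_sum_trace`; the tree's
  `card_mul_finrank_iInf_eqLocus_eq_sum_trace` is the case `R = ℤ_ℓ`, proved the same way: `N = Σ_g τ(g)` has `N² = |G| N`,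
  `tr N = |G| rk Im N`, `|G| V^G ⊆ Im N ⊆ V^G`; Serre §2.3 "`(χ|1) = dim V^G`");
* §2 **THE TWO-SIDED CHARACTER ON A POWER**: for endomorphisms `A` of `Y^ι` with scalar blocks `a_{ij} • φ` and `B` of `Y'^κ` with blocks
  `b_{kl} • ψ`, the operator `f ↦ A ≫ f ≫ B` of the free `ℤ`-module `Hom(Y^ι, Y'^κ)` has trace
  **`tr(a) · tr(b) · tr(h ↦ φ ≫ h ≫ ψ | Hom(Y, Y'))`** (`trace_leftComp_rightComp_eq_of_blocks`; compress to the `(j, k)` blocks and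
  use `tr(CD) = tr(DC)` — Serre §2.3 Lemma 2 / Ex. 2.6 (b): the character of `Hom(V, W)` is `χ_V(g⁻¹) χ_W(g)`);
* §3 **`|G| · rk_ℤ Hom_G(Y ⊗ M, Y' ⊗ N) = Σ_g tr m(g⁻¹) · tr n(g) · tr(h ↦ β(g⁻¹) h β'(g) | Hom(Y, Y'))`** for the twisted tensors
  (`card_mul_finrank_equivariantHom_eq_sum`: `Hom_G` is the fixed module of `τ(g) f = ρ(g⁻¹) f ρ'(g)` on `Hom(X, X')`), and for the
  untwisted tensors **`|G| · rk_ℤ Hom_G(Y ⊗ M, Y' ⊗ N) = (Σ_g tr m(g⁻¹) tr n(g)) · rk_ℤ Hom(Y, Y')`**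
  (`card_mul_finrank_equivariantHom_eq`) — i.e. `rk Hom_G(Y ⊗ M, Y' ⊗ N) = rk Hom_{ℤ[G]}(M, N) · rk Hom(Y, Y')`, since
  `|G| rk Hom_{ℤ[G]}(M, N) = Σ_g χ_M(g⁻¹) χ_N(g)`: the injection (ii) of MRS Prop. 1.6 has finite index.  (For general group actions
  the tree only bounds `rk Hom_G` by the `ℓ`-adic count — `finrank_equivariantHom_le`, equality being Tate's conjecture; for lattice
  tensors the count is exact and elementary.)

Everything is a theorem; no new definitions (the action `τ` on `Hom(X, X')` is built inside the proofs).

## References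

* [MazurRubinSilverberg2007] B. Mazur, K. Rubin, A. Silverberg, *Twisting commutative algebraic groups*, J. Algebra 314 (2007), Prop. 1.6
  (i)–(ii) (`Hom_𝒪(I, J) ⊗ Hom(V, W) ≅ Hom_{k^s}(I ⊗ V, J ⊗ W)`, restricting to an injection `Hom_{𝒪[G_k]}(I, J) ⊗ Hom_k(V, W) ↪
  Hom_k(I ⊗ V, J ⊗ W)`), Cor. 1.7.  Held `paper:doi-10-1016-j-jalgebra-2007-02-052`, p. 5 read.
* [SerreLinearRepresentations1977] J.-P. Serre, *Linear Representations of Finite Groups*, GTM 42, §2.1 Prop. 1 (ii)–(iii), §2.3 (Thm. 4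
  Cor.: multiplicities; Lemma 2 / Ex. 2.6 (b): the character of `Hom(W₁, W₂)`), §7.3 (intertwining numbers).  Held, PDF pp. 15, 19–21 read.
* [LangeRodriguez2022] H. Lange, R. E. Rodríguez, *Decomposition of Jacobians by Prym Varieties*, LNM 2310 (2022), §2.7 (2.18)
  (`⟨ρ_H, V⟩ = dim V^H`), §2.9.1 Prop. 2.9.3 proof (PDF p. 46).
* [Milne1986AbelianVarieties] J. S. Milne, *Abelian varieties*, in Cornell–Silverman (1986), §12 Lemma 12.2, Thm. 12.5 (pp. 189–190).
* [MumfordAV1970] D. Mumford, *Abelian Varieties* (1970), §19 Thm. 3 (p. 176: `Hom(X, Y)` is free of finite rank).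
-/

noncomputable section

open CategoryTheory CategoryTheory.Limits
open Literature.NumberTheory.DiophantineGeometry

universe u

namespace Literature.AlgebraicGeometry.Motives

namespace AbelianVariety

namespace LatticeTensor

/-! ## §1 `|G| · rk V^G = Σ_g tr τ(g)` for a representation on a free module of finite rank over a domain of characteristic `0` -/

section Invariants

variable {R : Type*} [CommRing R] {V : Type*} [AddCommGroup V] [Module R V]
  {G : Type} [Group G] [Fintype G] (τ : G →* Module.End R V)

/-- The norm `N = Σ_g τ(g)` is a quasi-idempotent: `N N = |G| • N` (`N τ(h) = N` by reindexing `g ↦ g h`).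
[cite: SerreLinearRepresentations1977, §2.3] -/
theorem sum_mul_sum_eq_card_smul' : (∑ g, τ g) * (∑ g, τ g) = (Fintype.card G : R) • ∑ g, τ g := by
  have h1 : ∀ h : G, (∑ g, τ g) * τ h = ∑ g, τ g := fun h ↦ by
    rw [Finset.sum_mul]
    simp_rw [← map_mul]
    exact Fintype.sum_equiv (Equiv.mulRight h) _ _ fun _ ↦ rfl
  rw [Finset.mul_sum]
  simp_rw [h1]
  rw [Finset.sum_const, Finset.card_univ, Nat.cast_smul_eq_nsmul]

/-- `N x = |G| • x` for `x ∈ V^G`. [cite: SerreLinearRepresentations1977, §2.3] -/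
theorem sum_apply_of_mem_invariants {x : V} (hx : x ∈ ⨅ g : G, LinearMap.eqLocus (τ g) LinearMap.id) :
    (∑ g, τ g) x = (Fintype.card G : R) • x := by
  rw [Submodule.mem_iInf] at hx
  have hx' : ∀ g, τ g x = x := fun g ↦ by
    have := LinearMap.mem_eqLocus.1 (hx g); rwa [LinearMap.id_apply] at this
  rw [LinearMap.sum_apply]
  simp_rw [hx']
  rw [Finset.sum_const, Finset.card_univ, Nat.cast_smul_eq_nsmul]

variable [IsDomain R] [IsPrincipalIdealRing R] [CharZero R] [Module.Free R V] [Module.Finite R V]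

omit [CharZero R] in
/-- **`tr(N) = |G| · rk Im N`** for `N = Σ_g τ(g)` (`N` factors as `V ↠ Im N ↪ V`, the other composite is `|G| · id`; `R` a principal
ideal domain, so that `Im N` is again free of finite rank). [cite: LangeRodriguez2022, §2.9.1 Prop. 2.9.3, proof (PDF p. 46)] [cite: SerreLinearRepresentations1977, §2.3] -/
theorem trace_sum_eq_card_mul_finrank_range' :
    LinearMap.trace R V (∑ g, τ g) = Fintype.card G * Module.finrank R (LinearMap.range (∑ g, τ g)) := by
  set N : Module.End R V := ∑ g, τ g with hN
  have hfac : (LinearMap.range N).subtype ∘ₗ N.rangeRestrict = N := LinearMap.ext fun _ ↦ rfl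
  have hother : N.rangeRestrict ∘ₗ (LinearMap.range N).subtype = (Fintype.card G : R) • LinearMap.id := by
    refine LinearMap.ext fun y ↦ Subtype.ext ?_
    obtain ⟨x, hx⟩ := LinearMap.mem_range.1 y.2
    change N (y : V) = (((Fintype.card G : R) • y : LinearMap.range N) : V)
    rw [Submodule.coe_smul, ← hx, ← Module.End.mul_apply, hN, sum_mul_sum_eq_card_smul', ← hN, LinearMap.smul_apply]
  have htr : LinearMap.trace R V N =
      LinearMap.trace R (LinearMap.range N) (N.rangeRestrict ∘ₗ (LinearMap.range N).subtype) := by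
    conv_lhs => rw [← hfac]
    rw [LinearMap.trace_comp_comm']
  rw [htr, hother, map_smul, LinearMap.trace_id, smul_eq_mul]

/-- **`rk Im N = rk V^G`**: `Im N ⊆ V^G` and `|G| · V^G ⊆ Im N`, `|G| ≠ 0` acting injectively on the free module `V` over the principal
ideal domain `R` of characteristic `0`. [cite: SerreLinearRepresentations1977, §2.3] [cite: LangeRodriguez2022, §2.7 (2.18)] -/
theorem finrank_range_sum_eq_finrank_invariants :
    Module.finrank R (LinearMap.range (∑ g, τ g)) =
      Module.finrank R (⨅ g : G, LinearMap.eqLocus (τ g) LinearMap.id : Submodule R V) := by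
  set W : Submodule R V := ⨅ g : G, LinearMap.eqLocus (τ g) LinearMap.id with hW
  -- `Im N ⊆ V^G`: `τ(h) N = N` by reindexing `g ↦ h g`
  have hle : LinearMap.range (∑ g, τ g) ≤ W := by
    rintro _ ⟨x, rfl⟩
    rw [hW, Submodule.mem_iInf]
    intro h
    refine LinearMap.mem_eqLocus.2 ?_
    have h2 : τ h * ∑ g, τ g = ∑ g, τ g := by
      rw [Finset.mul_sum]
      simp_rw [← map_mul]
      exact Fintype.sum_equiv (Equiv.mulLeft h) _ _ fun _ ↦ rfl
    rw [LinearMap.id_apply, ← Module.End.mul_apply, h2]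
  refine le_antisymm (Submodule.finrank_mono hle) ?_
  have hmem : ∀ x : W, (Fintype.card G : R) • (x : V) ∈ LinearMap.range (∑ g, τ g) := fun x ↦
    LinearMap.mem_range.2 ⟨x, sum_apply_of_mem_invariants τ x.2⟩
  let f : W →ₗ[R] LinearMap.range (∑ g, τ g) :=
    LinearMap.codRestrict _ ((Fintype.card G : R) • W.subtype) fun x ↦ hmem x
  refine LinearMap.finrank_le_finrank_of_injective (f := f) fun x x' hxx' ↦ ?_
  have h := congrArg Subtype.val hxx'
  change (Fintype.card G : R) • (x : V) = (Fintype.card G : R) • (x' : V) at h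
  exact Subtype.ext (smul_right_injective V (Nat.cast_ne_zero.2 Fintype.card_ne_zero) h)

/-- **THE INTEGRAL MULTIPLICITY FORMULA `|G| · rk_R V^G = Σ_{g ∈ G} tr(τ(g) | V)`** for a representation `τ` of a finite group `G` on a
free module `V` of finite rank over a principal ideal domain `R` of characteristic `0` (`V^G = ⋂_g {x | τ(g) x = x}`; `|G|` need
not be invertible in `R` — e.g. `R = ℤ`; the tree's `card_mul_finrank_iInf_eqLocus_eq_sum_trace` is `R = ℤ_ℓ`). [cite: SerreLinearRepresentations1977, §2.3 Thm. 4 Cor. (`(χ|1)` counts the unit representation)]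
[cite: LangeRodriguez2022, §2.7 (2.18) (`⟨ρ_H, V⟩ = dim V^H`) and §2.9.1 Prop. 2.9.3, proof] -/
theorem card_mul_finrank_invariants_eq_sum_trace :
    (Fintype.card G : R) * Module.finrank R (⨅ g : G, LinearMap.eqLocus (τ g) LinearMap.id : Submodule R V) =
      ∑ g, LinearMap.trace R V (τ g) := by
  rw [← finrank_range_sum_eq_finrank_invariants τ, ← trace_sum_eq_card_mul_finrank_range' τ, map_sum]

end Invariants

variable {K : Type u} [Field K]

/-! ## §2 The two-sided character on powers: `tr(f ↦ A ≫ f ≫ B) = tr(a) · tr(b) · tr(h ↦ φ ≫ h ≫ ψ)` -/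

section TwoSided

variable {Y Y' : AbelianVariety K} {ι κ : Type} [Fintype ι] [Fintype κ]
  (b : Bicone (fun _ : ι ↦ Y)) (c : Bicone (fun _ : κ ↦ Y'))

/-- **The two-sided character on powers**: if `A ∈ End(Y^ι)` has scalar blocks `ι_j ≫ A ≫ π_i = a_{ij} • φ` and `B ∈ End(Y'^κ)` has
blocks `ι_l ≫ B ≫ π_k = b_{kl} • ψ`, then the endomorphism `f ↦ A ≫ f ≫ B` of the free `ℤ`-module `Hom(Y^ι, Y'^κ)` has trace
**`tr(a) · tr(b) · tr(h ↦ φ ≫ h ≫ ψ | Hom(Y, Y'))`** — `Hom(Y ⊗ M, Y' ⊗ N) = M^∨ ⊗ N ⊗ Hom(Y, Y')` and traces multiply; proof by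
compressing to the `(j, k)` blocks (`f ↦ ι_j ≫ f ≫ π_k`) and `tr(CD) = tr(DC)`. [cite: MazurRubinSilverberg2007, Prop. 1.6 (i)]
[cite: SerreLinearRepresentations1977, §2.1 Prop. 2 (ii) and §2.3 Ex. 2.6 (b)] [cite: MumfordAV1970, §19 Thm. 3 (p. 176)] -/
theorem trace_leftComp_rightComp_eq_of_blocks (hb : ∑ j, b.π j ≫ b.ι j = 𝟙 b.pt) (hc : ∑ k, c.π k ≫ c.ι k = 𝟙 c.pt)
    {A : b.pt ⟶ b.pt} {B : c.pt ⟶ c.pt} {a : Matrix ι ι ℤ} {b' : Matrix κ κ ℤ} {φ : Y ⟶ Y} {ψ : Y' ⟶ Y'}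
    (hA : ∀ i j : ι, b.ι j ≫ A ≫ b.π i = a i j • φ) (hB : ∀ k l : κ, c.ι l ≫ B ≫ c.π k = b' k l • ψ) :
    LinearMap.trace ℤ (b.pt ⟶ c.pt)
        ((Preadditive.leftComp c.pt A).toIntLinearMap ∘ₗ (Preadditive.rightComp b.pt B).toIntLinearMap) =
      a.trace * b'.trace *
        LinearMap.trace ℤ (Y ⟶ Y') ((Preadditive.leftComp Y' φ).toIntLinearMap ∘ₗ (Preadditive.rightComp Y ψ).toIntLinearMap) := by
  haveI : Module.Free ℤ (b.pt ⟶ c.pt) := module_free_hom_holds b.pt c.pt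
  haveI : Module.Finite ℤ (b.pt ⟶ c.pt) := module_finite_hom_holds b.pt c.pt
  haveI : Module.Free ℤ (Y ⟶ Y') := module_free_hom_holds Y Y'
  haveI : Module.Finite ℤ (Y ⟶ Y') := module_finite_hom_holds Y Y'
  -- compressions `C_{jk} f = ι_j ≫ f ≫ π_k` and decompressions `D_{jk} h = (A ≫ π_j) ≫ h ≫ (ι_k ≫ B)`
  set C : ι → κ → ((b.pt ⟶ c.pt) →ₗ[ℤ] (Y ⟶ Y')) := fun j k ↦
    (Preadditive.leftComp Y' (b.ι j)).toIntLinearMap ∘ₗ (Preadditive.rightComp b.pt (c.π k)).toIntLinearMap with hC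
  set D : ι → κ → ((Y ⟶ Y') →ₗ[ℤ] (b.pt ⟶ c.pt)) := fun j k ↦
    (Preadditive.leftComp c.pt (A ≫ b.π j)).toIntLinearMap ∘ₗ (Preadditive.rightComp Y (c.ι k ≫ B)).toIntLinearMap with hD
  set T₀ : (Y ⟶ Y') →ₗ[ℤ] (Y ⟶ Y') :=
    (Preadditive.leftComp Y' φ).toIntLinearMap ∘ₗ (Preadditive.rightComp Y ψ).toIntLinearMap with hT₀
  have hCapply : ∀ j k (f : b.pt ⟶ c.pt), C j k f = b.ι j ≫ f ≫ c.π k := fun j k f ↦ rfl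
  have hDapply : ∀ j k (h : Y ⟶ Y'), D j k h = (A ≫ b.π j) ≫ h ≫ c.ι k ≫ B := fun j k h ↦ rfl
  have hT₀apply : ∀ h : Y ⟶ Y', T₀ h = φ ≫ h ≫ ψ := fun h ↦ rfl
  -- `f ↦ A f B` is `Σ_{j,k} D_{jk} ∘ C_{jk}`
  have hT : (Preadditive.leftComp c.pt A).toIntLinearMap ∘ₗ (Preadditive.rightComp b.pt B).toIntLinearMap =
      ∑ j, ∑ k, D j k ∘ₗ C j k := by
    refine LinearMap.ext fun f ↦ ?_
    change A ≫ f ≫ B = _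
    simp only [LinearMap.sum_apply, LinearMap.comp_apply, hCapply, hDapply]
    conv_lhs => rw [eq_sum_matrix b c hb hc f]
    simp only [Preadditive.comp_sum, Preadditive.sum_comp, Category.assoc]
  -- each compression `C_{jk} D_{jk}` is `a_{jj} b_{kk} • T₀`
  have hCD : ∀ j k, C j k ∘ₗ D j k = (a j j * b' k k) • T₀ := by
    intro j k
    refine LinearMap.ext fun h ↦ ?_
    rw [LinearMap.comp_apply, hDapply, hCapply, LinearMap.smul_apply, hT₀apply]
    have e : b.ι j ≫ ((A ≫ b.π j) ≫ h ≫ c.ι k ≫ B) ≫ c.π k = (b.ι j ≫ A ≫ b.π j) ≫ h ≫ (c.ι k ≫ B ≫ c.π k) := by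
      simp only [Category.assoc]
    rw [e, hA j j, hB k k, Preadditive.zsmul_comp, Preadditive.comp_zsmul, Preadditive.comp_zsmul, smul_smul, mul_comm]
  have hjk : ∀ j k, LinearMap.trace ℤ (b.pt ⟶ c.pt) (D j k ∘ₗ C j k) =
      a j j * b' k k * LinearMap.trace ℤ (Y ⟶ Y') T₀ := fun j k ↦ by
    rw [LinearMap.trace_comp_comm', hCD, map_smul, smul_eq_mul]
  rw [hT, map_sum]
  simp_rw [map_sum, hjk]
  rw [Matrix.trace, Matrix.trace, Finset.sum_mul, Finset.sum_mul]
  refine Finset.sum_congr rfl fun j _ ↦ ?_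
  rw [Matrix.diag_apply, Finset.mul_sum, Finset.sum_mul]
  refine Finset.sum_congr rfl fun k _ ↦ ?_
  rw [Matrix.diag_apply]

end TwoSided

/-! ## §3 `|G| · rk_ℤ Hom_G(Y ⊗ M, Y' ⊗ N) = Σ_g tr m(g⁻¹) tr n(g) · (twist character)` and the untwisted count -/

section EquivariantHom

variable {Y Y' : AbelianVariety K} {ι κ : Type} [Fintype ι] [Fintype κ] [DecidableEq ι] [DecidableEq κ]
  (b : Bicone (fun _ : ι ↦ Y)) (c : Bicone (fun _ : κ ↦ Y')) {G : Type} [Group G] [Fintype G]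
  (m : G →* Matrix ι ι ℤ) (n : G →* Matrix κ κ ℤ) (β : G →* End Y) (β' : G →* End Y')
  (ρ : G →* End b.pt) (ρ' : G →* End c.pt)

omit [Fintype ι] [Fintype κ] [DecidableEq ι] [DecidableEq κ] in
/-- **`|G| · rk_ℤ Hom_G(X, X') = Σ_g tr(f ↦ ρ(g⁻¹) ≫ f ≫ ρ'(g) | Hom(X, X'))`** for actions `ρ`, `ρ'` of a finite group on abelian
varieties `X`, `X'` over any field: `Hom_G(X, X') = {f | ρ(g) f = f ρ'(g)}` is the fixed module of the action `τ(g) f = ρ(g⁻¹) f ρ'(g)`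
on the free `ℤ`-module `Hom(X, X')`, and §1 applies over `R = ℤ` (the character of `Hom(V, W)`; intertwining numbers).
[cite: SerreLinearRepresentations1977, §2.3 Thm. 4 Cor. and Ex. 2.6 (b), §7.3] [cite: LangeRodriguez2022, §2.7 (2.18)]
[cite: MumfordAV1970, §19 Thm. 3 (p. 176)] -/
theorem card_mul_finrank_equivariantHom_eq_sum_trace {X X' : AbelianVariety K} (σ : G →* End X) (σ' : G →* End X') :
    (Fintype.card G : ℤ) *
        Module.finrank ℤ (⨅ g : G, LinearMap.eqLocus (Preadditive.leftComp X' (End.asHom (σ g))).toIntLinearMap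
          (Preadditive.rightComp X (End.asHom (σ' g))).toIntLinearMap : Submodule ℤ (X ⟶ X')) =
      ∑ g, LinearMap.trace ℤ (X ⟶ X')
        ((Preadditive.leftComp X' (End.asHom (σ g⁻¹))).toIntLinearMap ∘ₗ
          (Preadditive.rightComp X (End.asHom (σ' g))).toIntLinearMap) := by
  haveI : Module.Free ℤ (X ⟶ X') := module_free_hom_holds X X'
  haveI : Module.Finite ℤ (X ⟶ X') := module_finite_hom_holds X X'
  -- the conjugation action `τ(g) f = σ(g⁻¹) ≫ f ≫ σ'(g)` on `Hom(X, X')`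
  let τ : G →* Module.End ℤ (X ⟶ X') :=
    { toFun := fun g ↦ (Preadditive.leftComp X' (End.asHom (σ g⁻¹))).toIntLinearMap ∘ₗ
        (Preadditive.rightComp X (End.asHom (σ' g))).toIntLinearMap
      map_one' := by
        refine LinearMap.ext fun f ↦ ?_
        change End.asHom (σ 1⁻¹) ≫ f ≫ End.asHom (σ' 1) = f
        rw [inv_one, asHom_map_one_eq_id, asHom_map_one_eq_id, Category.id_comp, Category.comp_id]
      map_mul' := fun g h ↦ by
        refine LinearMap.ext fun f ↦ ?_
        change End.asHom (σ (g * h)⁻¹) ≫ f ≫ End.asHom (σ' (g * h)) =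
          End.asHom (σ g⁻¹) ≫ (End.asHom (σ h⁻¹) ≫ f ≫ End.asHom (σ' h)) ≫ End.asHom (σ' g)
        rw [mul_inv_rev, asHom_map_mul_eq_comp, asHom_map_mul_eq_comp]
        simp only [Category.assoc] }
  have hτ : ∀ g (f : X ⟶ X'), τ g f = End.asHom (σ g⁻¹) ≫ f ≫ End.asHom (σ' g) := fun g f ↦ rfl
  -- its fixed module is `Hom_G(X, X')`
  have hfix : (⨅ g : G, LinearMap.eqLocus (τ g) LinearMap.id : Submodule ℤ (X ⟶ X')) =
      ⨅ g : G, LinearMap.eqLocus (Preadditive.leftComp X' (End.asHom (σ g))).toIntLinearMap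
        (Preadditive.rightComp X (End.asHom (σ' g))).toIntLinearMap := by
    ext f
    rw [mem_iInf_eqLocus_leftComp_rightComp_iff σ σ' f, Submodule.mem_iInf]
    simp only [LinearMap.mem_eqLocus, LinearMap.id_apply, hτ]
    constructor
    · intro h g
      have h1 := congrArg (fun φ ↦ End.asHom (σ g) ≫ φ) (h g)
      simp only [← Category.assoc, asHom_comp_asHom_inv, Category.id_comp] at h1
      exact h1.symm
    · intro h g
      rw [← h g, ← Category.assoc, asHom_inv_comp_asHom, Category.id_comp]
  rw [← hfix, card_mul_finrank_invariants_eq_sum_trace τ]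
  rfl

/-- **THE EQUIVARIANT `Hom`-COUNT FOR TWISTED LATTICE TENSORS**:
`|G| · rk_ℤ Hom_G(Y ⊗_β M, Y' ⊗_{β'} N) = Σ_g tr m(g⁻¹) · tr n(g) · tr(h ↦ β(g⁻¹) ≫ h ≫ β'(g) | Hom(Y, Y'))` — the character of
`Hom(X, X') = M^∨ ⊗ N ⊗ Hom(Y, Y')` is the product of the three characters (§2), and `|G| rk Hom_G = Σ_g` of it (§1).
[cite: MazurRubinSilverberg2007, Prop. 1.6 (i)–(ii)] [cite: SerreLinearRepresentations1977, §2.1 Prop. 2 (ii), §2.3 Thm. 4 Cor. and Ex. 2.6 (b)] -/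
theorem card_mul_finrank_equivariantHom_eq_sum (hb : ∑ j, b.π j ≫ b.ι j = 𝟙 b.pt) (hc : ∑ k, c.π k ≫ c.ι k = 𝟙 c.pt)
    (hρ : ∀ (g : G) (i j : ι), b.ι j ≫ End.asHom (ρ g) ≫ b.π i = m g i j • End.asHom (β g))
    (hρ' : ∀ (g : G) (k l : κ), c.ι l ≫ End.asHom (ρ' g) ≫ c.π k = n g k l • End.asHom (β' g)) :
    (Fintype.card G : ℤ) *
        Module.finrank ℤ (⨅ g : G, LinearMap.eqLocus (Preadditive.leftComp c.pt (End.asHom (ρ g))).toIntLinearMap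
          (Preadditive.rightComp b.pt (End.asHom (ρ' g))).toIntLinearMap : Submodule ℤ (b.pt ⟶ c.pt)) =
      ∑ g, (m g⁻¹).trace * (n g).trace *
        LinearMap.trace ℤ (Y ⟶ Y') ((Preadditive.leftComp Y' (End.asHom (β g⁻¹))).toIntLinearMap ∘ₗ
          (Preadditive.rightComp Y (End.asHom (β' g))).toIntLinearMap) := by
  rw [card_mul_finrank_equivariantHom_eq_sum_trace ρ ρ']
  exact Finset.sum_congr rfl fun g _ ↦ trace_leftComp_rightComp_eq_of_blocks b c hb hc (hρ g⁻¹) (hρ' g)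

omit [Fintype ι] [Fintype κ] [DecidableEq ι] [DecidableEq κ] [Fintype G] in
/-- `tr(h ↦ 𝟙 ≫ h ≫ 𝟙 | Hom(Y, Y')) = rk_ℤ Hom(Y, Y')`. [cite: MumfordAV1970, §19 Thm. 3 (p. 176)] -/
theorem trace_leftComp_id_rightComp_id :
    LinearMap.trace ℤ (Y ⟶ Y') ((Preadditive.leftComp Y' (𝟙 Y)).toIntLinearMap ∘ₗ (Preadditive.rightComp Y (𝟙 Y')).toIntLinearMap) =
      Module.finrank ℤ (Y ⟶ Y') := by
  haveI : Module.Free ℤ (Y ⟶ Y') := module_free_hom_holds Y Y'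
  haveI : Module.Finite ℤ (Y ⟶ Y') := module_finite_hom_holds Y Y'
  have h : (Preadditive.leftComp Y' (𝟙 Y)).toIntLinearMap ∘ₗ (Preadditive.rightComp Y (𝟙 Y')).toIntLinearMap = LinearMap.id :=
    LinearMap.ext fun f ↦ show 𝟙 Y ≫ f ≫ 𝟙 Y' = f by rw [Category.id_comp, Category.comp_id]
  rw [h, LinearMap.trace_id]

/-- **THE EQUIVARIANT `Hom`-COUNT FOR LATTICE TENSORS (MRS Prop. 1.6 (ii), counted):
`|G| · rk_ℤ Hom_G(Y ⊗ M, Y' ⊗ N) = (Σ_g tr m(g⁻¹) · tr n(g)) · rk_ℤ Hom(Y, Y')`** for the untwisted tensors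
(`ι_j ρ(g) π_i = m(g)_{ij} • 𝟙`, `ι_l ρ'(g) π_k = n(g)_{kl} • 𝟙`) over ANY field — since `Σ_g χ_M(g⁻¹) χ_N(g) = |G| rk Hom_{ℤ[G]}(M, N)`,
this is `rk Hom_G(Y ⊗ M, Y' ⊗ N) = rk Hom_{ℤ[G]}(M, N) · rk Hom(Y, Y')`: the injection `Hom_{𝒪[G]}(I, J) ⊗ Hom(V, W) ↪ Hom(I ⊗ V, J ⊗ W)`
has finite index. [cite: MazurRubinSilverberg2007, Prop. 1.6 (ii)] [cite: SerreLinearRepresentations1977, §2.3 Ex. 2.6 (b) and §7.3]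
[cite: Milne1986AbelianVarieties, §12 Lemma 12.2 (p. 189)] -/
theorem card_mul_finrank_equivariantHom_eq (hb : ∑ j, b.π j ≫ b.ι j = 𝟙 b.pt) (hc : ∑ k, c.π k ≫ c.ι k = 𝟙 c.pt)
    (hρ₁ : ∀ (g : G) (i j : ι), b.ι j ≫ End.asHom (ρ g) ≫ b.π i = m g i j • 𝟙 Y)
    (hρ'₁ : ∀ (g : G) (k l : κ), c.ι l ≫ End.asHom (ρ' g) ≫ c.π k = n g k l • 𝟙 Y') :
    (Fintype.card G : ℤ) *
        Module.finrank ℤ (⨅ g : G, LinearMap.eqLocus (Preadditive.leftComp c.pt (End.asHom (ρ g))).toIntLinearMap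
          (Preadditive.rightComp b.pt (End.asHom (ρ' g))).toIntLinearMap : Submodule ℤ (b.pt ⟶ c.pt)) =
      (∑ g, (m g⁻¹).trace * (n g).trace) * Module.finrank ℤ (Y ⟶ Y') := by
  rw [card_mul_finrank_equivariantHom_eq_sum_trace ρ ρ', Finset.sum_mul]
  refine Finset.sum_congr rfl fun g _ ↦ ?_
  rw [trace_leftComp_rightComp_eq_of_blocks b c hb hc (hρ₁ g⁻¹) (hρ'₁ g), trace_leftComp_id_rightComp_id]

/-- **`rk_ℤ Hom_G(Y ⊗ M, Y' ⊗ N) = d · rk_ℤ Hom(Y, Y')` whenever `|G| · d = Σ_g tr m(g⁻¹) tr n(g)`** (`d = rk Hom_{ℤ[G]}(M, N)`; any field).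
[cite: MazurRubinSilverberg2007, Prop. 1.6 (ii)] [cite: SerreLinearRepresentations1977, §7.3 (intertwining numbers)] -/
theorem finrank_equivariantHom_eq_of_card_mul_eq (hb : ∑ j, b.π j ≫ b.ι j = 𝟙 b.pt) (hc : ∑ k, c.π k ≫ c.ι k = 𝟙 c.pt)
    (hρ₁ : ∀ (g : G) (i j : ι), b.ι j ≫ End.asHom (ρ g) ≫ b.π i = m g i j • 𝟙 Y)
    (hρ'₁ : ∀ (g : G) (k l : κ), c.ι l ≫ End.asHom (ρ' g) ≫ c.π k = n g k l • 𝟙 Y') {d : ℕ}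
    (hd : (Fintype.card G : ℤ) * d = ∑ g, (m g⁻¹).trace * (n g).trace) :
    Module.finrank ℤ (⨅ g : G, LinearMap.eqLocus (Preadditive.leftComp c.pt (End.asHom (ρ g))).toIntLinearMap
        (Preadditive.rightComp b.pt (End.asHom (ρ' g))).toIntLinearMap : Submodule ℤ (b.pt ⟶ c.pt)) =
      d * Module.finrank ℤ (Y ⟶ Y') := by
  have h := card_mul_finrank_equivariantHom_eq b c m n ρ ρ' hb hc hρ₁ hρ'₁
  rw [← hd, mul_assoc] at h
  exact_mod_cast mul_left_cancel₀ (Nat.cast_ne_zero.2 Fintype.card_ne_zero : (Fintype.card G : ℤ) ≠ 0) h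

/-- **The equivariant endomorphism count `|G| · rk_ℤ End_G(Y ⊗ M) = (Σ_g tr m(g⁻¹) tr m(g)) · rk_ℤ End Y`** (untwisted; any field):
`End_G(Y ⊗ M) ⊇ End_{ℤ[G]}(M) ⊗ End Y` with finite index — e.g. for `M = ℤ[G/H]` the count `|H\G/H| · rk End Y` of the Hecke algebra.
[cite: MazurRubinSilverberg2007, Prop. 1.6 (ii) and Prop. 4.2 (iii)] [cite: SerreLinearRepresentations1977, §2.3 Ex. 2.6 (b) and §7.3] -/
theorem card_mul_finrank_equivariantEnd_eq (hb : ∑ j, b.π j ≫ b.ι j = 𝟙 b.pt)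
    (hρ₁ : ∀ (g : G) (i j : ι), b.ι j ≫ End.asHom (ρ g) ≫ b.π i = m g i j • 𝟙 Y) :
    (Fintype.card G : ℤ) *
        Module.finrank ℤ (⨅ g : G, LinearMap.eqLocus (Preadditive.leftComp b.pt (End.asHom (ρ g))).toIntLinearMap
          (Preadditive.rightComp b.pt (End.asHom (ρ g))).toIntLinearMap : Submodule ℤ (b.pt ⟶ b.pt)) =
      (∑ g, (m g⁻¹).trace * (m g).trace) * Module.finrank ℤ (Y ⟶ Y) :=
  card_mul_finrank_equivariantHom_eq b b m m ρ ρ hb hb hρ₁ hρ₁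

end EquivariantHom

end LatticeTensor

end AbelianVariety

end Literature.AlgebraicGeometry.Motives
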